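import Literature.Probability.Percolation.SlabRSWGluingExtB
import HarnessLib

/-!
# Newman–Tassion–Wu 2017, §3.2 — routes with feeder paths: moving the ends of the trunk along
# lattice chains

Topic: `Literature/Probability/Percolation`. The tree's routing theorem `exists_route` (DST 2016,
Fact 2: the three disjoint paths of the rerouting) works inside a full rectangle; in the remaining
geometries of NTW's §3 (L-shaped pieces of a domain near an inner corner, boxes cut by a slit, the
clipped corner squares of Theorem 3.10) the three terminals `E₁, E₂, w'` may sit outside any such
rectangle and are brought into it along FEEDER chains. The tree has the one-step adapters
`RouteSpec.cons_trunk` / `concat_trunk` / `concat_branch` and the chain version for the branch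
(`RouteSpec.append_branch`); this file adds the chain versions for the two ends of the trunk:

* `RouteSpec.prepend_trunk` — a self-avoiding lattice chain `X` ending next to `E₁`, off the trunk and
  the branch, makes a route from `X.head`;
* `RouteSpec.append_trunk` — a chain `X` starting next to `E₂` makes a route to `X.getLast`.

So a route in any region reduces to a route in a rectangle plus three pairwise disjoint feeder chains.

## Sources

* C. M. Newman, V. Tassion, W. Wu, *Critical percolation and the minimal spanning tree in slabs*,
  Comm. Pure Appl. Math. 70 (2017), arXiv:1512.09107: §3.2, proof of Theorem 3.7, step (3) (the
  paths `γ_u, γ_v, γ_w`), Remark 2 (rectilinear domains) [NewmanTassionWu2017].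
* H. Duminil-Copin, V. Sidoravicius, V. Tassion, CPAM 69 (2016), §2.3, proof of Fact 2
  [DuminilCopinSidoraviciusTassion2016].
-/

noncomputable section

namespace Literature.Probability.Percolation

open LatticeModels SimpleGraph

namespace NTW17

variable {k : ℕ}

variable {Db : Set (ℤ × ℤ)} {E₁ E₂ w' c : slab 3 k} {Br : List (slab 3 k)}

/-- **Appending a lattice chain to the trunk of a route**: if `X` continues the trunk from its end
`E₂` as a self-avoiding lattice chain off the trunk and off the branch, over the (enlarged) trunk
region, the result is a route ending at the last vertex of `X`.
[cite: NewmanTassionWu2017, §3.2 (proof of Theorem 3.7, step (3), the path γ_v)] -/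
theorem RouteSpec.append_trunk :
    ∀ {RP RP' : Set (ℤ × ℤ)} (_hRP : RP ⊆ RP') (X : List (slab 3 k)) (E₂ : slab 3 k) (L : List (slab 3 k)) (hX : X ≠ []),
      RouteSpec k RP Db E₁ E₂ w' L Br c →
      (E₂ :: X).IsChain (fun a b => (slabGraph 3 k).Adj a b) → X.Nodup →
      (∀ x ∈ X, x ∉ L) → (∀ x ∈ X, x ∉ Br) → (∀ x ∈ X, planar k x ∈ RP') →
      RouteSpec k RP' Db E₁ (X.getLast hX) w' (L ++ X) Br c
  | _, _, _, [], _, _, hX, _, _, _, _, _, _ => absurd rfl hX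
  | RP, RP', hRP, x :: X', E₂, L, hX, h, hch, hnd, hXL, hXBr, hXRP => by
    have hadj : (slabGraph 3 k).Adj E₂ x := by
      rw [List.isChain_cons] at hch
      exact hch.1 x (by simp)
    have hch' : (x :: X').IsChain (fun a b => (slabGraph 3 k).Adj a b) := by
      rw [List.isChain_cons] at hch
      exact hch.2
    have h₁ : RouteSpec k RP' Db E₁ x w' (L ++ [x]) Br c :=
      RouteSpec.concat_trunk h hRP hadj (hXL x (by simp)) (hXBr x (by simp)) (hXRP x (by simp))
    by_cases hX' : X' = []
    · subst hX'
      simpa using h₁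
    · have hxX' : x ∉ X' := (List.nodup_cons.1 hnd).1
      have ih := RouteSpec.append_trunk (subset_rfl : RP' ⊆ RP') X' x (L ++ [x]) hX' h₁ hch'
        (List.nodup_cons.1 hnd).2
        (fun y hy hm => by
          rcases List.mem_append.1 hm with hm | hm
          · exact hXL y (List.mem_cons_of_mem _ hy) hm
          · rw [List.mem_singleton] at hm
            exact hxX' (hm ▸ hy))
        (fun y hy => hXBr y (List.mem_cons_of_mem _ hy))
        (fun y hy => hXRP y (List.mem_cons_of_mem _ hy))
      rw [List.getLast_cons hX']
      simpa using ih

/-- **Prepending a lattice chain to the trunk of a route**: if `X` is a self-avoiding lattice chain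
ending next to the start `E₁` of the trunk, off the trunk and off the branch, over the (enlarged)
trunk region, the result is a route starting at the head of `X`.
[cite: NewmanTassionWu2017, §3.2 (proof of Theorem 3.7, step (3), the path γ_u)] -/
theorem RouteSpec.prepend_trunk {RP RP' : Set (ℤ × ℤ)} (hRP : RP ⊆ RP') :
    ∀ (X : List (slab 3 k)) (E₁ : slab 3 k) (L : List (slab 3 k)) (hX : X ≠ []),
      RouteSpec k RP Db E₁ E₂ w' L Br c →
      (X ++ [E₁]).IsChain (fun a b => (slabGraph 3 k).Adj a b) → X.Nodup →
      (∀ x ∈ X, x ∉ L) → (∀ x ∈ X, x ∉ Br) → (∀ x ∈ X, planar k x ∈ RP') →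
      RouteSpec k RP' Db (X.head hX) E₂ w' (X ++ L) Br c
  | [], _, _, hX, _, _, _, _, _, _ => absurd rfl hX
  | x :: X', E₁, L, hX, h, hch, hnd, hXL, hXBr, hXRP => by
    by_cases hX' : X' = []
    · subst hX'
      have hadj : (slabGraph 3 k).Adj x E₁ := by
        simp only [List.nil_append, List.cons_append, List.isChain_cons_cons] at hch
        exact hch.1
      simpa using RouteSpec.cons_trunk h hRP hadj (hXL x (by simp)) (hXBr x (by simp)) (hXRP x (by simp))
    · -- first prepend the tail `X'`, then the vertex `x`
      have hch' : (X' ++ [E₁]).IsChain (fun a b => (slabGraph 3 k).Adj a b) := by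
        rw [List.cons_append] at hch
        exact hch.tail
      have ih := RouteSpec.prepend_trunk hRP X' E₁ L hX' h hch' (List.nodup_cons.1 hnd).2
        (fun y hy => hXL y (List.mem_cons_of_mem _ hy)) (fun y hy => hXBr y (List.mem_cons_of_mem _ hy))
        (fun y hy => hXRP y (List.mem_cons_of_mem _ hy))
      have hadj : (slabGraph 3 k).Adj x (X'.head hX') := by
        obtain ⟨y, t, rfl⟩ := List.exists_cons_of_ne_nil hX'
        simp only [List.cons_append, List.isChain_cons_cons] at hch
        simpa using hch.1
      have hxX' : x ∉ X' := (List.nodup_cons.1 hnd).1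
      have hres := RouteSpec.cons_trunk ih subset_rfl hadj
        (fun hm => by
          rcases List.mem_append.1 hm with hm | hm
          · exact hxX' hm
          · exact hXL x (by simp) hm)
        (hXBr x (by simp)) (hXRP x (by simp))
      simpa using hres

end NTW17

end Literature.Probability.Percolation

end
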